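import Summits.ValiantsHypothesis.ValiantsHypothesis.Theorems.LacunarySymmetroidMatrixDescartesFiniteSectorRealisableThreeFour
import Summits.ValiantsHypothesis.ValiantsHypothesis.Theorems.LacunarySymmetroidMatrixDescartesFiniteSectorEtaTwoSix
import Summits.ValiantsHypothesis.ValiantsHypothesis.Theorems.LacunarySymmetroidMatrixDescartesFiniteSectorStampCeilingKThree

/-!
# `MatrixDescartes` — line «finite»: the stamp ceiling `ν(3,4) ≤ 15 = n(3,3)` BY NAME (`StampLawAt 3 4 15`),
# hence `ν(3,4) = 15` EXACT on both sides; and the doubled row `η(3,4) ≥ 30` (`¬ HypRootLawAt 3 4 29`)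

HONEST FRAMING.  Object-search cell `pub-symmetroid`, seat val-sym-eng-3 g4 (desk pub-symmetroid R2487 (A): «taking StampLawAt 3 4»).
HELPER of the crux item `stmt-ValiantsHypothesis-18050` (`Theses.LacunarySymmetroid.MatrixDescartes`, asymptotic in `K`) with NO
closure claim.  Postage-stamp bookkeeping on top of the PROVED ceiling T3 of line «finite»
(`…FiniteSector.mem_sumset_of_fullPos`): with FOUR exponents whose `m`-fold sumset contains `0` and `1`, the exponent values are
`{0, 1, x, y}`, every `m`-fold sum is `p + q·x + s·y` with `p + q + s ≤ m` (three denominations `1, x, y`, at most `m` stamps), so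
any three-denomination postage-stamp bound gives `StampLawAt m 4 N` (`stampLawAt_four_of_stamps`).  For `m = 3` the bound
`n(3,3) = 15` is a finite check (`decide` over `x, y ≤ 16` + a large-value reduction to the `K = 3` row):
`stampLawAt_three_four : StampLawAt 3 4 15`.  With the seat's witness `fullyRealisable_three_0145_fifteen`
(`…FiniteSectorRealisableThreeFour`) the row `ν(3,4) = 15` is EXACT on both sides in the kernel
(`not_stampLawAt_three_four_14`), and doubling (door-p5's adapter `not_hypRootLawAt_of_fullyRealisable`, T2) gives the sector row
`¬ HypRootLawAt 3 4 29`, i.e. `η(3,4) ≥ 30` (supersedes `not_hypRootLawAt_three_four_23` by name).  The matching sector CEILING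
`HypRootLawAt 3 4 30` (gap-rule sieve) is NOT proved here.  Nothing here bears on the crux or on `VP ≠ VNP`.
[folklore] Postage-stamp (three denominations, Rohrbach/Stöhr tables: `n(3,3) = 15`) bookkeeping; no citation is load-bearing.
-/

-- `Summit.ValiantsHypothesis.ValiantsHypothesis.…` repeats a component by the D-0017 layout
-- (single-conjunct summit), which the `dupNamespace` linter flags; the name is mandated.
set_option linter.dupNamespace false

namespace Summit.ValiantsHypothesis.ValiantsHypothesis.Theorems.LacunarySymmetroidMatrixDescartes.FiniteSector

open scoped BigOperators Matrix
open Polynomial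

/-! ## §1 Four exponents whose sumset contains `0` and `1` take only the values `0, 1, x, y` -/

/-- Four indices: if `d a = 0` and `d b = 1` then every value of `d : Fin 4 → ℕ` is `0`, `1` or one of the two remaining
values. [folklore] -/
theorem values_fin_four (d : Fin 4 → ℕ) (a b : Fin 4) (ha : d a = 0) (hb : d b = 1) :
    ∃ x y, ∀ i, d i = 0 ∨ d i = 1 ∨ d i = x ∨ d i = y := by
  have hab : a ≠ b := fun h => by rw [h] at ha; omega
  obtain ⟨c, c', hc⟩ : ∃ c c' : Fin 4, ∀ i : Fin 4, i = a ∨ i = b ∨ i = c ∨ i = c' := by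
    fin_cases a <;> fin_cases b <;> first
      | exact absurd rfl hab
      | exact ⟨2, 3, by decide⟩
      | exact ⟨1, 3, by decide⟩
      | exact ⟨1, 2, by decide⟩
      | exact ⟨0, 3, by decide⟩
      | exact ⟨0, 2, by decide⟩
      | exact ⟨0, 1, by decide⟩
  refine ⟨d c, d c', fun i => ?_⟩
  rcases hc i with h | h | h | h
  · exact Or.inl (h ▸ ha)
  · exact Or.inr (Or.inl (h ▸ hb))
  · exact Or.inr (Or.inr (Or.inl (h ▸ rfl)))
  · exact Or.inr (Or.inr (Or.inr (h ▸ rfl)))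

/-- With the exponent values among `{0, 1, x, y}`, every multiset sum of exponents is `p + q·x + s·y` with `p + q + s ≤ card`.
[folklore] -/
theorem sum_eq_stamps₃ {K : ℕ} (d : Fin K → ℕ) (x y : ℕ) (hd : ∀ i, d i = 0 ∨ d i = 1 ∨ d i = x ∨ d i = y) :
    ∀ (s : Multiset (Fin K)), ∃ p q r : ℕ, p + q + r ≤ Multiset.card s ∧ (s.map d).sum = p + q * x + r * y := by
  intro s
  induction s using Multiset.induction_on with
  | empty => exact ⟨0, 0, 0, by simp, by simp⟩
  | cons i t ih =>
    obtain ⟨p, q, r, hpq, hsum⟩ := ih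
    rw [Multiset.map_cons, Multiset.sum_cons, Multiset.card_cons, hsum]
    rcases hd i with h | h | h | h
    · exact ⟨p, q, r, by omega, by rw [h]; ring⟩
    · exact ⟨p + 1, q, r, by omega, by rw [h]; ring⟩
    · exact ⟨p, q + 1, r, by omega, by rw [h]; ring⟩
    · exact ⟨p, q, r + 1, by omega, by rw [h]; ring⟩

/-! ## §2 The `K = 4` stamp ceiling from a three-denomination postage-stamp bound -/

/-- **`K = 4` stamp ceiling, abstract form.**  If for every `x, y` some `r ≤ N + 1` is not of the form `p + q·x + s·y` with
`p + q + s ≤ m`, then `StampLawAt m 4 N`. (T3 `mem_sumset_of_fullPos` + §1; the `K = 3` sibling is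
`stampLawAt_three_of_stamps`.) [folklore] -/
theorem stampLawAt_four_of_stamps {m N : ℕ} (hm : 1 ≤ m)
    (hN : ∀ x y : ℕ, ∃ r, r ≤ N + 1 ∧ ∀ p q s : ℕ, p + q + s ≤ m → p + q * x + s * y ≠ r) :
    StampLawAt m 4 N := by
  intro d S hS hfull
  by_contra hdeg'
  have hdeg : N < (pencil d S).det.natDegree := not_le.mp hdeg'
  have hq : (pencil d S).det ≠ 0 := by
    intro h0
    rw [h0] at hdeg
    simp at hdeg
  have hmem : ∀ r, r ≤ (pencil d S).det.natDegree →
      ∃ s : Multiset (Fin 4), Multiset.card s = m ∧ (s.map d).sum = r := by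
    intro r hr
    have h := mem_sumset_of_fullPos d S hq hfull hr
    rw [Finset.mem_image] at h
    obtain ⟨s, -, hs⟩ := h
    exact ⟨(s : Multiset (Fin 4)), s.2, hs⟩
  obtain ⟨s0, hs0c, hs0⟩ := hmem 0 (Nat.zero_le _)
  obtain ⟨a, ha⟩ := exists_eq_zero_of_sum_eq_zero d s0
    (by intro h; rw [h] at hs0c; simp at hs0c; omega) hs0
  obtain ⟨s1, -, hs1⟩ := hmem 1 (by omega)
  obtain ⟨b, hb⟩ := exists_eq_one_of_sum_eq_one d s1 hs1
  obtain ⟨x, y, hxy⟩ := values_fin_four d a b ha hb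
  obtain ⟨r, hrN, hr⟩ := hN x y
  obtain ⟨s, hsc, hs⟩ := hmem r (by omega)
  obtain ⟨p, q, t, hpq, hsum⟩ := sum_eq_stamps₃ d x y hxy s
  exact hr p q t (by omega) (by omega)

/-! ## §3 The numeric row `m = 3`: three denominations `1, x, y`, three stamps never cover `[0, 16]` (`n(3,3) = 15`) -/

/-- The `K = 3` row `m = 3` as a lemma: stamps `{1, y}`, at most three of them, miss some `r ≤ 8`. [folklore] -/
theorem stamps_two_denominations_three (y : ℕ) : ∃ r, r ≤ 8 ∧ ∀ p s : ℕ, p + s ≤ 3 → p + s * y ≠ r := by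
  rcases Nat.lt_or_ge y 5 with hy | hy
  · interval_cases y
    · exact ⟨4, by norm_num, fun p s hps h => by omega⟩
    · exact ⟨4, by norm_num, fun p s hps h => by omega⟩
    · exact ⟨7, by norm_num, fun p s hps h => by omega⟩
    · exact ⟨8, by norm_num, fun p s hps h => by omega⟩
    · exact ⟨7, by norm_num, fun p s hps h => by omega⟩
  · refine ⟨4, by norm_num, fun p s hps h => ?_⟩
    rcases Nat.eq_zero_or_pos s with hs | hs
    · subst hs; omega
    · have : y ≤ s * y := Nat.le_mul_of_pos_left y hs
      omega

/-- The finite core, `x, y ≤ 16`: checked by `decide` (bounded quantifiers only). [folklore] -/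
theorem stamps_three_denominations_three_small :
    ∀ x ∈ Finset.range 17, ∀ y ∈ Finset.range 17, ∃ r ∈ Finset.range 17,
      ∀ q ∈ Finset.range 4, ∀ s ∈ Finset.range 4, ∀ p ∈ Finset.range 4, p + q + s ≤ 3 → p + q * x + s * y ≠ r := by
  decide +kernel

/-- **Three denominations `1, x, y`, at most three stamps, never cover `[0, 16]`** (`n(3,3) = 15`, Rohrbach/Stöhr). [folklore] -/
theorem stamps_three_denominations_three (x y : ℕ) :
    ∃ r, r ≤ 16 ∧ ∀ p q s : ℕ, p + q + s ≤ 3 → p + q * x + s * y ≠ r := by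
  rcases Nat.lt_or_ge x 17 with hx | hx
  · rcases Nat.lt_or_ge y 17 with hy | hy
    · obtain ⟨r, hr, h⟩ := stamps_three_denominations_three_small x (Finset.mem_range.2 hx) y (Finset.mem_range.2 hy)
      refine ⟨r, by have := Finset.mem_range.1 hr; omega, fun p q s hpqs => ?_⟩
      exact h q (Finset.mem_range.2 (by omega)) s (Finset.mem_range.2 (by omega)) p (Finset.mem_range.2 (by omega))
        (by omega)
    · -- `y` large: it cannot be used below `17`; reduce to the stamps `{1, x}`
      obtain ⟨r, hr, h⟩ := stamps_two_denominations_three x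
      refine ⟨r, by omega, fun p q s hpqs hsum => ?_⟩
      rcases Nat.eq_zero_or_pos s with hs | hs
      · subst hs
        exact h p q (by omega) (by simpa using hsum)
      · have : y ≤ s * y := Nat.le_mul_of_pos_left y hs
        omega
  · -- `x` large: reduce to the stamps `{1, y}`
    obtain ⟨r, hr, h⟩ := stamps_two_denominations_three y
    refine ⟨r, by omega, fun p q s hpqs hsum => ?_⟩
    rcases Nat.eq_zero_or_pos q with hq | hq
    · subst hq
      exact h p s (by omega) (by simpa using hsum)
    · have : x ≤ q * x := Nat.le_mul_of_pos_left x hq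
      omega

/-! ## §4 The rows by name -/

/-- **`ν(3,4) ≤ 15 = n(3,3)`**: every full-positive-rooted determinant of a real symmetric `3 × 3` half-pencil with `4` terms has
degree `≤ 15` — for ALL supports `d : Fin 4 → ℕ`. [folklore] -/
theorem stampLawAt_three_four : StampLawAt 3 4 15 :=
  stampLawAt_four_of_stamps (by norm_num) stamps_three_denominations_three

/-- **`ν(3,4) = 15` is EXACT: the ceiling `14` fails** (witness `fullyRealisable_three_0145_fifteen` on `(0,1,4,5)`). [folklore] -/
theorem not_stampLawAt_three_four_14 : ¬ StampLawAt 3 4 14 := by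
  intro h
  obtain ⟨S, hS, hfull, hdeg⟩ := fullyRealisable_three_0145_fifteen
  have := h _ S hS hfull
  omega

/-- **`η(3,4) ≥ 30`**: `¬ HypRootLawAt 3 4 29` — the doubled F6 realisation: an in-sector (all roots real and simple) symmetric
`(3,4)` pencil on `(0,2,8,10)` of degree `30` (adapter `not_hypRootLawAt_of_fullyRealisable`, T2).  Supersedes
`not_hypRootLawAt_three_four_23` by name. [folklore] -/
theorem not_hypRootLawAt_three_four_29 : ¬ HypRootLawAt 3 4 29 :=
  not_hypRootLawAt_of_fullyRealisable fullyRealisable_three_0145_fifteen (by norm_num)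

end Summit.ValiantsHypothesis.ValiantsHypothesis.Theorems.LacunarySymmetroidMatrixDescartes.FiniteSector
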